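import Summits.CriticalPhenomena.SAWScalingLimit.Theorems.SAWTotalPositivityBoundaryTP2StripCertPoly
import HarnessLib

/-!
# Crux `BoundaryTP2` (stmt-CriticalPhenomena-7115), line `Sketch`: `StripCert` part 2 — certified linear
constraints on a box, box invariance under a polynomial transfer matrix, trajectories (kernel-decidable)

Part 2 of the lead's all-length certificate kit.  A *box* around an anchor coordinate `z 0 ≥ 0` is
`L_i z 0 ≤ Dn z i ≤ H_i z 0` (`InBox`, integer data `L H Dn`).  `consCheck` certifies a linear constraint
`Σ_j g_j(x) z_j ≥ 0` (integer polynomials `g_j`) for every `x` in a rational interval and every `z` in the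
box, by the term-by-term bound in the `G`-transformed cell domain of part 1 (`dotV_nonneg_of_consCheck`);
`boxStepCheck T …` certifies that the real linear map `z ↦ T(x) z` (`mulTV`, `T` a matrix of integer
polynomials) maps the box into itself (`inBox_mulTV_of_boxStepCheck`), whence every real trajectory driven by
`T(x)` that enters the box stays in it (`inBox_traj`).  All `Bool` tests run by `decide`; everything is
proved. [folklore]
-/

namespace Summit.CriticalPhenomena.SAWScalingLimit.Theorems.BoundaryTP2.StripCert

open Summit.CriticalPhenomena.SAWScalingLimit.Theorems.BoundaryTP2.Negative.Cert

/-! ## §4 Vectors of polynomials, boxes, and certified linear constraints -/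

/-- Real semantics of a list of integer polynomials applied to a real vector from index `i` on:
`dotV [g₀,g₁,…] x z i = Σ_j g_j(x) · z (i+j)`. [folklore] -/
noncomputable def dotV : List (List ℤ) → ℝ → (ℕ → ℝ) → ℕ → ℝ
  | [], _, _, _ => 0
  | g :: gs, x, z, i => evZ g x * z i + dotV gs x z (i + 1)

/-- Evaluation of the empty list. [folklore] -/
@[simp] theorem dotV_nil (x : ℝ) (z : ℕ → ℝ) (i : ℕ) : dotV [] x z i = 0 := rfl

/-- One step. [folklore] -/
@[simp] theorem dotV_cons (g : List ℤ) (gs : List (List ℤ)) (x : ℝ) (z : ℕ → ℝ) (i : ℕ) :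
    dotV (g :: gs) x z i = evZ g x * z i + dotV gs x z (i + 1) := rfl

/-- **The box** with integer ratio bounds `L, H` and denominator `Dn` around the anchor coordinate `0`:
`z 0 ≥ 0` and `L_i · z 0 ≤ Dn · z i ≤ H_i · z 0` for `i < k`. [folklore] -/
def InBox (L H : List ℤ) (Dn k : ℕ) (z : ℕ → ℝ) : Prop :=
  0 ≤ z 0 ∧ ∀ i, i < k → ((L.getD i 0 : ℤ) : ℝ) * z 0 ≤ (Dn : ℝ) * z i ∧ (Dn : ℝ) * z i ≤ ((H.getD i 0 : ℤ) : ℝ) * z 0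

/-- The term-by-term bound coefficient: `γ·L` if `γ ≥ 0`, else `γ·H`. [folklore] -/
def splitCoeff (γ L H : ℤ) : ℤ := if 0 ≤ γ then γ * L else γ * H

/-- The basic inequality behind `splitCoeff`. [folklore] -/
theorem splitCoeff_le (γ L H : ℤ) {Dn w z0 zj : ℝ} (hw : 0 ≤ w) (hlo : (L : ℝ) * z0 ≤ Dn * zj)
    (hhi : Dn * zj ≤ (H : ℝ) * z0) : ((splitCoeff γ L H : ℤ) : ℝ) * w * z0 ≤ (γ : ℝ) * w * (Dn * zj) := by
  unfold splitCoeff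
  split_ifs with h
  · have hγ : (0 : ℝ) ≤ γ := by exact_mod_cast h
    push_cast
    nlinarith [mul_le_mul_of_nonneg_left hlo (mul_nonneg hγ hw)]
  · have hγ : (γ : ℝ) ≤ 0 := by exact_mod_cast (not_le.1 h).le
    push_cast
    nlinarith [mul_le_mul_of_nonpos_left hhi (mul_nonpos_of_nonpos_of_nonneg hγ hw)]

/-- Coefficientwise `splitCoeff`. [folklore] -/
def splitPoly (L H : ℤ) (G : List ℤ) : List ℤ := G.map fun γ => splitCoeff γ L H

/-- **Term-by-term bound**: for `u ≥ 0` and `L z0 ≤ Dn zj ≤ H z0`,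
`(splitPoly L H G)(u) · z0 ≤ G(u) · Dn zj`. [folklore] -/
theorem evZ_splitPoly_le (L H : ℤ) {Dn z0 zj u : ℝ} (hu : 0 ≤ u) (hlo : (L : ℝ) * z0 ≤ Dn * zj)
    (hhi : Dn * zj ≤ (H : ℝ) * z0) :
    ∀ G : List ℤ, evZ (splitPoly L H G) u * z0 ≤ evZ G u * (Dn * zj)
  | [] => by simp [splitPoly]
  | γ :: gs => by
    have ih := evZ_splitPoly_le L H hu hlo hhi gs
    have h0 := splitCoeff_le γ L H (w := 1) zero_le_one hlo hhi
    rw [splitPoly, List.map_cons, evZ_cons, ← splitPoly, evZ_cons]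
    nlinarith [mul_le_mul_of_nonneg_left ih hu]

/-- Sum of the term-by-term bound polynomials of `[G_i, G_{i+1}, …]` against the bounds `L_i, H_i, …`. [folklore] -/
def boundSum (L H : List ℤ) : ℕ → List (List ℤ) → List ℤ
  | _, [] => []
  | i, G :: Gs => addZ (splitPoly (L.getD i 0) (H.getD i 0) G) (boundSum L H (i + 1) Gs)

/-- **The summed term-by-term bound** inside the box (coordinates `i, i+1, … < k`). [folklore] -/
theorem evZ_boundSum_le {L H : List ℤ} {Dn k : ℕ} {z : ℕ → ℝ} (hz : InBox L H Dn k z) {u : ℝ} (hu : 0 ≤ u) :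
    ∀ (Gs : List (List ℤ)) (i : ℕ), i + Gs.length ≤ k →
      evZ (boundSum L H i Gs) u * z 0 ≤ (Dn : ℝ) * dotV Gs u z i
  | [], i, _ => by simp [boundSum]
  | G :: Gs, i, hk => by
    have hik : i < k := by simp only [List.length_cons] at hk; omega
    obtain ⟨hlo, hhi⟩ := hz.2 i hik
    have h1 := evZ_splitPoly_le (L.getD i 0) (H.getD i 0) hu hlo hhi G
    have h2 := evZ_boundSum_le hz hu Gs (i + 1) (by simp only [List.length_cons] at hk; omega)
    rw [boundSum, evZ_addZ, dotV_cons]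
    nlinarith

/-- The cell transform of part 3 applied to a (padded) constraint polynomial:
`cellPoly a m D N n c g = G`-transform of `N^{n-1} D^{n-1} g((a + m (c+s)/N)/D)`. [folklore] -/
def cellPoly (a m : ℤ) (D N n c : ℕ) (g : List ℤ) : List ℤ :=
  bernG (shiftH (c : ℤ) (N : ℤ) (scaleZ m (shiftH a D (padZ n g))))

/-- The right-end value `D^{n-1} g((a+m)/D)`. [folklore] -/
def endVal (a m : ℤ) (D n : ℕ) (g : List ℤ) : ℤ := (scaleZ m (shiftH a D (padZ n g))).sum

/-- Length of `addZ`. [folklore] -/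
theorem length_addZ : ∀ p q : List ℤ, (addZ p q).length = max p.length q.length
  | [], q => by simp [addZ]
  | a :: p, [] => by simp [addZ]
  | a :: p, b :: q => by rw [addZ, List.length_cons, length_addZ p q, List.length_cons, List.length_cons]; omega

/-- Length of `mulLinZ`. [folklore] -/
theorem length_mulLinZ (a : ℤ) (p : List ℤ) : (mulLinZ a p).length = p.length + 1 := by
  rw [mulLinZ, length_addZ, smulZ, List.length_map, List.length_cons]; omega

/-- `shiftH` preserves the length. [folklore] -/
theorem length_shiftH (a D : ℤ) : ∀ E : List ℤ, (shiftH a D E).length = E.length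
  | [] => rfl
  | e :: es => by
    rw [shiftH, length_addZ, length_mulLinZ, length_shiftH a D es, List.length_singleton, List.length_cons]; omega

/-- `scaleZ` preserves the length. [folklore] -/
theorem length_scaleZ (m : ℤ) : ∀ P : List ℤ, (scaleZ m P).length = P.length
  | [] => rfl
  | c :: cs => by simp [scaleZ, smulZ, length_scaleZ m cs]

/-- **Semantics of `cellPoly`**: a common positive factor times `g(x)`. [folklore] -/
theorem evZ_cellPoly {a m : ℤ} {D N n c : ℕ} (hD : 0 < D) (hN : 0 < N) {g : List ℤ} (hg : g.length ≤ n)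
    {u : ℝ} (hu : 1 + u ≠ 0) :
    evZ (cellPoly a m D N n c g) u =
      ((1 + u) ^ (n - 1) * ((N : ℝ) ^ (n - 1) * ((D : ℝ) ^ (n - 1)))) *
        evZ g (((a : ℝ) + m * (((c : ℝ) + u / (1 + u)) / N)) / D) := by
  have hD' : (D : ℝ) ≠ 0 := by exact_mod_cast hD.ne'
  have hN' : (N : ℝ) ≠ 0 := by exact_mod_cast hN.ne'
  have hl1 : (padZ n g).length = n := length_padZ hg
  have hl2 : (shiftH a D (padZ n g)).length = n := by rw [length_shiftH, hl1]
  have hl3 : (scaleZ m (shiftH a D (padZ n g))).length = n := by rw [length_scaleZ, hl2]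
  have hl4 : (shiftH (c : ℤ) (N : ℤ) (scaleZ m (shiftH a D (padZ n g)))).length = n := by
    rw [length_shiftH, hl3]
  rw [cellPoly, evZ_bernG hu, hl4, evZ_shiftH (c : ℤ) (N : ℤ) (by push_cast; exact hN'), hl3, evZ_scaleZ,
    evZ_shiftH (a : ℤ) (D : ℤ) (by push_cast; exact hD'), hl1, evZ_padZ]
  push_cast
  ring

/-- **Semantics of `endVal`**: `D^{n-1} g((a+m)/D)`. [folklore] -/
theorem endVal_eq {a m : ℤ} {D n : ℕ} (hD : 0 < D) {g : List ℤ} (hg : g.length ≤ n) :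
    ((endVal a m D n g : ℤ) : ℝ) = (D : ℝ) ^ (n - 1) * evZ g (((a : ℝ) + m) / D) := by
  have hD' : (D : ℝ) ≠ 0 := by exact_mod_cast hD.ne'
  have hl1 : (padZ n g).length = n := length_padZ hg
  rw [endVal, ← evZ_one_eq_sum, evZ_scaleZ, evZ_shiftH (a : ℤ) (D : ℤ) (by push_cast; exact hD'), hl1,
    evZ_padZ]
  push_cast
  ring_nf

/-- The bound polynomial of the constraint `Σ_j g_j(x) z_j ≥ 0` (`gs = [g_0, g_1, …]`, `g_0` the anchor
coefficient) on cell `c`. [folklore] -/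
def consCellPoly (a m : ℤ) (D N n Dn c : ℕ) (L H : List ℤ) (gs : List (List ℤ)) : List ℤ :=
  match gs with
  | [] => []
  | g0 :: rest => addZ (smulZ Dn (cellPoly a m D N n c g0)) (boundSum L H 1 (rest.map (cellPoly a m D N n c)))

/-- Sum of `splitCoeff` bounds of end values `[σ_i, σ_{i+1}, …]`. [folklore] -/
def boundEnd (L H : List ℤ) : ℕ → List ℤ → ℤ
  | _, [] => 0
  | i, σ :: σs => splitCoeff σ (L.getD i 0) (H.getD i 0) + boundEnd L H (i + 1) σs

/-- The bound of the constraint at the right end point. [folklore] -/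
def consEnd (a m : ℤ) (D n Dn : ℕ) (L H : List ℤ) (gs : List (List ℤ)) : ℤ :=
  match gs with
  | [] => 0
  | g0 :: rest => Dn * endVal a m D n g0 + boundEnd L H 1 (rest.map (endVal a m D n))

/-- **The constraint test**: all cells and the end point, plus the degree bound. [folklore] -/
def consCheck (a m : ℤ) (D N n Dn : ℕ) (L H : List ℤ) (gs : List (List ℤ)) : Bool :=
  (gs.all fun g => decide (g.length ≤ n)) &&
    ((List.range N).all fun c => allNonneg (consCellPoly a m D N n Dn c L H gs)) &&
      decide (0 ≤ consEnd a m D n Dn L H gs)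

/-- `dotV` of mapped lists, cell version: the common factor comes out. [folklore] -/
theorem dotV_map_cellPoly {a m : ℤ} {D N n c : ℕ} (hD : 0 < D) (hN : 0 < N) {u : ℝ} (hu : 1 + u ≠ 0)
    (z : ℕ → ℝ) : ∀ (rest : List (List ℤ)) (i : ℕ), (∀ g ∈ rest, g.length ≤ n) →
      dotV (rest.map (cellPoly a m D N n c)) u z i =
        ((1 + u) ^ (n - 1) * ((N : ℝ) ^ (n - 1) * ((D : ℝ) ^ (n - 1)))) *
          dotV rest (((a : ℝ) + m * (((c : ℝ) + u / (1 + u)) / N)) / D) z i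
  | [], i, _ => by simp
  | g :: gs, i, h => by
    rw [List.map_cons, dotV_cons, dotV_cons, evZ_cellPoly hD hN (h g (by simp)) hu,
      dotV_map_cellPoly hD hN hu z gs (i + 1) (fun g' hg' => h g' (by simp [hg']))]
    ring

/-- End-point version of the term-by-term bound. [folklore] -/
theorem boundEnd_le {a m : ℤ} {D n Dn k : ℕ} (hD : 0 < D) {L H : List ℤ} {z : ℕ → ℝ} (hz : InBox L H Dn k z) :
    ∀ (rest : List (List ℤ)) (i : ℕ), (∀ g ∈ rest, g.length ≤ n) → i + rest.length ≤ k →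
      ((boundEnd L H i (rest.map (endVal a m D n)) : ℤ) : ℝ) * z 0 ≤
        (Dn : ℝ) * ((D : ℝ) ^ (n - 1) * dotV rest (((a : ℝ) + m) / D) z i)
  | [], i, _, _ => by simp [boundEnd]
  | g :: gs, i, hlen, hk => by
    have hik : i < k := by simp only [List.length_cons] at hk; omega
    obtain ⟨hlo, hhi⟩ := hz.2 i hik
    have h1 := splitCoeff_le (endVal a m D n g) (L.getD i 0) (H.getD i 0) (w := 1) zero_le_one hlo hhi
    rw [endVal_eq hD (hlen g (by simp))] at h1
    have h2 := boundEnd_le (a := a) (m := m) hD hz gs (i + 1) (fun g' hg' => hlen g' (by simp [hg']))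
      (by simp only [List.length_cons] at hk; omega)
    rw [List.map_cons, boundEnd, dotV_cons]
    push_cast
    have hDp : (0 : ℝ) ≤ (D : ℝ) ^ (n - 1) := by positivity
    nlinarith [h1, h2]

/-- **Soundness of the constraint test**: inside the box, `Σ_j g_j(x) z_j ≥ 0` on the whole interval. [folklore] -/
theorem dotV_nonneg_of_consCheck {a m : ℤ} {D N n Dn k : ℕ} (hD : 0 < D) (hm : 0 < m) (hN : 0 < N)
    {L H : List ℤ} {gs : List (List ℤ)} (h : consCheck a m D N n Dn L H gs = true) (hk : gs.length ≤ k)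
    {x : ℝ} (h1 : (a : ℝ) / D ≤ x) (h2 : x ≤ ((a : ℝ) + m) / D) {z : ℕ → ℝ} (hz : InBox L H Dn k z)
    (hDn : 0 < Dn) : 0 ≤ dotV gs x z 0 := by
  simp only [consCheck, Bool.and_eq_true, List.all_eq_true, decide_eq_true_eq] at h
  obtain ⟨⟨hlen, hcells⟩, hend⟩ := h
  cases gs with
  | nil => simp
  | cons g0 rest =>
  have hlen0 : g0.length ≤ n := hlen g0 (by simp)
  have hlenr : ∀ g ∈ rest, g.length ≤ n := fun g hg => hlen g (by simp [hg])
  have hD' : (0 : ℝ) < D := by exact_mod_cast hD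
  have hm' : (0 : ℝ) < m := by exact_mod_cast hm
  have hN' : (0 : ℝ) < N := by exact_mod_cast hN
  have hDn' : (0 : ℝ) < Dn := by exact_mod_cast hDn
  have hz0 : 0 ≤ z 0 := hz.1
  have hrk : 1 + rest.length ≤ k := by simpa [add_comm] using hk
  -- affine parameter
  set t := ((D : ℝ) * x - a) / m with ht
  have hDx1 : (a : ℝ) ≤ D * x := by rwa [div_le_iff₀ hD', mul_comm] at h1
  have hDx2 : (D : ℝ) * x ≤ a + m := by rwa [le_div_iff₀ hD', mul_comm] at h2
  have ht0 : 0 ≤ t := div_nonneg (by linarith) hm'.le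
  have ht1 : t ≤ 1 := by rw [ht, div_le_one hm']; linarith
  have hx : x = ((a : ℝ) + m * t) / D := by rw [ht]; field_simp; ring
  rw [dotV_cons]
  rcases ht1.lt_or_eq with hlt | heq
  · -- inside a cell
    set c : ℕ := ⌊(N : ℝ) * t⌋₊ with hc
    have hNt : 0 ≤ (N : ℝ) * t := by positivity
    have hct : (c : ℝ) ≤ N * t := Nat.floor_le hNt
    have htc : (N : ℝ) * t < c + 1 := Nat.lt_floor_add_one _
    have hcN : c < N := by
      have hc1 : (c : ℝ) < N := lt_of_le_of_lt hct (by nlinarith)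
      exact_mod_cast hc1
    set s := (N : ℝ) * t - c with hs
    have hs0 : 0 ≤ s := by linarith
    have hs1 : s < 1 := by linarith
    have h1s : 0 < 1 - s := by linarith
    set u := s / (1 - s) with hu
    have hu0 : 0 ≤ u := div_nonneg hs0 h1s.le
    have h1u : (0 : ℝ) < 1 + u := by linarith
    have hsu : u / (1 + u) = s := by rw [hu]; field_simp; ring
    have hxu : ((a : ℝ) + m * (((c : ℝ) + u / (1 + u)) / N)) / D = x := by
      rw [hsu, hx, hs]; field_simp; ring
    have hcell := hcells c (List.mem_range.2 hcN)
    have hG := evZ_nonneg_of_allNonneg hcell hu0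
    rw [consCellPoly, evZ_addZ, evZ_smulZ, evZ_cellPoly hD hN hlen0 h1u.ne', hxu] at hG
    push_cast at hG
    have hB := evZ_boundSum_le hz hu0 (rest.map (cellPoly a m D N n c)) 1 (by simpa using hrk)
    rw [dotV_map_cellPoly hD hN h1u.ne' z rest 1 hlenr, hxu] at hB
    -- the common factor
    have hΦ : 0 < (1 + u) ^ (n - 1) * ((N : ℝ) ^ (n - 1) * ((D : ℝ) ^ (n - 1))) := by positivity
    set Φ := (1 + u) ^ (n - 1) * ((N : ℝ) ^ (n - 1) * ((D : ℝ) ^ (n - 1))) with hΦdef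
    -- (Dn Φ g0(x) + B(u)) ≥ 0 where B(u) z0 ≤ Dn Φ (rest·z); conclude Φ Dn (g0 z0 + rest·z) ≥ 0
    have key : 0 ≤ Φ * (Dn : ℝ) * (evZ g0 x * z 0 + dotV rest x z 1) := by
      have := mul_nonneg hG hz0
      linarith [this, hB]
    have hΦD : 0 < Φ * (Dn : ℝ) := mul_pos hΦ hDn'
    exact (mul_nonneg_iff_of_pos_left hΦD).1 (by linarith [key])
  · -- the right end point
    have hxe : ((a : ℝ) + m) / D = x := by rw [hx, heq]; ring
    have hB := boundEnd_le (a := a) (m := m) (n := n) hD hz rest 1 hlenr (by simpa using hrk)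
    rw [hxe] at hB
    have hE : (0 : ℝ) ≤ (consEnd a m D n Dn L H (g0 :: rest) : ℤ) := by exact_mod_cast hend
    rw [consEnd] at hE
    push_cast at hE
    rw [endVal_eq hD hlen0, hxe] at hE
    have hDp : (0 : ℝ) < (D : ℝ) ^ (n - 1) := by positivity
    have key : 0 ≤ (Dn : ℝ) * (D : ℝ) ^ (n - 1) * (evZ g0 x * z 0 + dotV rest x z 1) := by
      have := mul_nonneg hE hz0
      linarith [this, hB]
    exact (mul_nonneg_iff_of_pos_left (mul_pos hDn' hDp)).1 (by linarith [key])


/-! ## §5 Box invariance under a polynomial transfer matrix, and trajectories -/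

/-- Entry `(i,j)` of a matrix of integer polynomials (rows of entries; missing entries are `0`). [folklore] -/
def ent (T : List (List (List ℤ))) (i j : ℕ) : List ℤ := (T.getD i []).getD j []

/-- The real linear map `z ↦ T(x) z` on the first `k` coordinates. [folklore] -/
noncomputable def mulTV (T : List (List (List ℤ))) (k : ℕ) (x : ℝ) (z : ℕ → ℝ) : ℕ → ℝ :=
  fun i => ∑ j ∈ Finset.range k, evZ (ent T i j) x * z j

/-- `dotV` of an appended list. [folklore] -/
theorem dotV_append (x : ℝ) (z : ℕ → ℝ) : ∀ (l₁ l₂ : List (List ℤ)) (i : ℕ),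
    dotV (l₁ ++ l₂) x z i = dotV l₁ x z i + dotV l₂ x z (i + l₁.length)
  | [], l₂, i => by simp
  | g :: gs, l₂, i => by
    rw [List.cons_append, dotV_cons, dotV_cons, dotV_append x z gs l₂ (i + 1), List.length_cons]
    ring_nf

/-- `dotV` of a mapped `range` is a `Finset` sum. [folklore] -/
theorem dotV_map_range (f : ℕ → List ℤ) (x : ℝ) (z : ℕ → ℝ) :
    ∀ k : ℕ, dotV ((List.range k).map f) x z 0 = ∑ j ∈ Finset.range k, evZ (f j) x * z j
  | 0 => by simp
  | k + 1 => by
    rw [List.range_succ, List.map_append, dotV_append, dotV_map_range f x z k, Finset.sum_range_succ,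
      List.map_singleton, dotV_cons, dotV_nil, List.length_map, List.length_range]
    ring

/-- Constraint polynomials of the anchor sign `z'_0 ≥ 0`. [folklore] -/
def anchorCons (T : List (List (List ℤ))) (k : ℕ) : List (List ℤ) := (List.range k).map fun j => ent T 0 j

/-- Constraint polynomials of the lower bound `Dn z'_i - L_i z'_0 ≥ 0`. [folklore] -/
def loCons (T : List (List (List ℤ))) (Dn : ℕ) (L : List ℤ) (k i : ℕ) : List (List ℤ) :=
  (List.range k).map fun j => addZ (smulZ Dn (ent T i j)) (smulZ (-(L.getD i 0)) (ent T 0 j))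

/-- Constraint polynomials of the upper bound `H_i z'_0 - Dn z'_i ≥ 0`. [folklore] -/
def hiCons (T : List (List (List ℤ))) (Dn : ℕ) (H : List ℤ) (k i : ℕ) : List (List ℤ) :=
  (List.range k).map fun j => addZ (smulZ (H.getD i 0) (ent T 0 j)) (smulZ (-(Dn : ℤ)) (ent T i j))

/-- Semantics of `anchorCons`. [folklore] -/
theorem dotV_anchorCons (T : List (List (List ℤ))) (k : ℕ) (x : ℝ) (z : ℕ → ℝ) :
    dotV (anchorCons T k) x z 0 = mulTV T k x z 0 := by
  rw [anchorCons, dotV_map_range]; rfl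

/-- Semantics of `loCons`. [folklore] -/
theorem dotV_loCons (T : List (List (List ℤ))) (Dn : ℕ) (L : List ℤ) (k i : ℕ) (x : ℝ) (z : ℕ → ℝ) :
    dotV (loCons T Dn L k i) x z 0 = (Dn : ℝ) * mulTV T k x z i - ((L.getD i 0 : ℤ) : ℝ) * mulTV T k x z 0 := by
  rw [loCons, dotV_map_range, mulTV, mulTV, Finset.mul_sum, Finset.mul_sum, ← Finset.sum_sub_distrib]
  refine Finset.sum_congr rfl fun j _ => ?_
  rw [evZ_addZ, evZ_smulZ, evZ_smulZ]; push_cast; ring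

/-- Semantics of `hiCons`. [folklore] -/
theorem dotV_hiCons (T : List (List (List ℤ))) (Dn : ℕ) (H : List ℤ) (k i : ℕ) (x : ℝ) (z : ℕ → ℝ) :
    dotV (hiCons T Dn H k i) x z 0 = ((H.getD i 0 : ℤ) : ℝ) * mulTV T k x z 0 - (Dn : ℝ) * mulTV T k x z i := by
  rw [hiCons, dotV_map_range, mulTV, mulTV, Finset.mul_sum, Finset.mul_sum, ← Finset.sum_sub_distrib]
  refine Finset.sum_congr rfl fun j _ => ?_
  rw [evZ_addZ, evZ_smulZ, evZ_smulZ]; push_cast; ring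

/-- **The box-invariance test** for `T` on `[a/D, (a+m)/D]` (cells `N`, degree bound `n`, box `L, H, Dn`, dimension `k`). [folklore] -/
def boxStepCheck (T : List (List (List ℤ))) (k : ℕ) (L H : List ℤ) (Dn : ℕ) (a m : ℤ) (D N n : ℕ) : Bool :=
  consCheck a m D N n Dn L H (anchorCons T k) &&
    (List.range k).all fun i =>
      consCheck a m D N n Dn L H (loCons T Dn L k i) && consCheck a m D N n Dn L H (hiCons T Dn H k i)

/-- **Soundness of the box-invariance test**: the box is mapped into itself by `T(x)` for every `x` in the
interval. [folklore] -/
theorem inBox_mulTV_of_boxStepCheck {T : List (List (List ℤ))} {k : ℕ} {L H : List ℤ} {Dn : ℕ} {a m : ℤ}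
    {D N n : ℕ} (h : boxStepCheck T k L H Dn a m D N n = true) (hD : 0 < D) (hm : 0 < m) (hN : 0 < N)
    (hDn : 0 < Dn) {x : ℝ} (h1 : (a : ℝ) / D ≤ x) (h2 : x ≤ ((a : ℝ) + m) / D) {z : ℕ → ℝ}
    (hz : InBox L H Dn k z) : InBox L H Dn k (mulTV T k x z) := by
  simp only [boxStepCheck, Bool.and_eq_true, List.all_eq_true] at h
  obtain ⟨h0, hi⟩ := h
  refine ⟨?_, fun i hik => ⟨?_, ?_⟩⟩
  · have := dotV_nonneg_of_consCheck hD hm hN h0 (by simp [anchorCons]) h1 h2 hz hDn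
    rwa [dotV_anchorCons] at this
  · have := dotV_nonneg_of_consCheck hD hm hN (hi i (List.mem_range.2 hik)).1 (by simp [loCons]) h1 h2 hz hDn
    rw [dotV_loCons] at this; linarith
  · have := dotV_nonneg_of_consCheck hD hm hN (hi i (List.mem_range.2 hik)).2 (by simp [hiCons]) h1 h2 hz hDn
    rw [dotV_hiCons] at this; linarith

/-- `InBox` only sees the first `k` coordinates (and the anchor). [folklore] -/
theorem InBox.congr {L H : List ℤ} {Dn k : ℕ} {z z' : ℕ → ℝ} (hz : InBox L H Dn k z) (h0 : z' 0 = z 0)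
    (h : ∀ i, i < k → z' i = z i) : InBox L H Dn k z' := by
  refine ⟨h0 ▸ hz.1, fun i hi => ?_⟩
  rw [h i hi, h0]; exact hz.2 i hi

/-- `mulTV` only reads the first `k` coordinates. [folklore] -/
theorem mulTV_congr (T : List (List (List ℤ))) (k : ℕ) (x : ℝ) {z z' : ℕ → ℝ} (h : ∀ j, j < k → z' j = z j)
    (i : ℕ) : mulTV T k x z' i = mulTV T k x z i :=
  Finset.sum_congr rfl fun j hj => by rw [h j (Finset.mem_range.1 hj)]

/-- **Trajectories stay in an invariant box**: a real sequence of vectors driven by `T(x)` on its first `k`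
coordinates that is in the box at `n₀` is in the box at every `n ≥ n₀`. [folklore] -/
theorem inBox_traj {T : List (List (List ℤ))} {k : ℕ} {L H : List ℤ} {Dn : ℕ} {a m : ℤ} {D N n : ℕ}
    (h : boxStepCheck T k L H Dn a m D N n = true) (hD : 0 < D) (hm : 0 < m) (hN : 0 < N) (hDn : 0 < Dn)
    (hk : 0 < k) {x : ℝ} (h1 : (a : ℝ) / D ≤ x) (h2 : x ≤ ((a : ℝ) + m) / D) {z : ℕ → ℕ → ℝ}
    (hrec : ∀ t i, i < k → z (t + 1) i = mulTV T k x (z t) i) {n₀ : ℕ} (hz : InBox L H Dn k (z n₀)) :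
    ∀ t, n₀ ≤ t → InBox L H Dn k (z t) := by
  intro t ht
  induction t, ht using Nat.le_induction with
  | base => exact hz
  | succ t _ ih =>
    exact (inBox_mulTV_of_boxStepCheck h hD hm hN hDn h1 h2 ih).congr (hrec t 0 hk) fun i hi => hrec t i hi


end Summit.CriticalPhenomena.SAWScalingLimit.Theorems.BoundaryTP2.StripCert
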